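import Summits.QuantumFields.YangMills.Theorems.FluctuationComparisonRegPrIntLOrganTangentGradientFromAnalytic
import Summits.QuantumFields.YangMills.Theorems.FluctuationComparisonRegPrIntLOrganTangentRelPathWindow
import Summits.QuantumFields.YangMills.Theorems.FluctuationComparisonRegPrIntLOrganTangentJunctionDirectTransportCore
import HarnessLib

/-!
# Crux `FluctuationComparisonRegPrIntL` (stmt-QuantumFields-20520, rung R3), PATH-B organ, H-currency cone — (L40) «PATH-LIPSCHITZ OF AN ANALYTIC-WINDOW FUNCTIONAL FROM (β) +
# BONDWISE EXPONENTIAL INCREMENTS»: the (logρ-Lip) ∕ (logρ′-Lip) letters of ✓(L39b) `…OrganTangentWeightLipOfChartLetters` from the ROW'S OWN run hypothesis (β) (one-bond-square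
# analyticity of `log ρ_Ts`, `log ρ′_Ts`) and ONE bondwise chart-increment letter — so the densities enter the (I-law) REGULARITY debt only through (β)

Cell `ym3-torus` (YM ladder rung R3 = continuum `SU(2)` Yang–Mills on the three-torus — a RUNG: NOT d = 4, NOT infinite volume, NOT a mass gap, NOT Clay).
Width seat `ym-ust-20520-w5` (gen 25), `--kind proof --supports stmt-QuantumFields-20520 --as helper`, count-neutral, DEFINITION-FREE, default heartbeats,
no registry ∕ binder ∕ `Lines/` edit.  Over ✓`…OrganTangentGradientFromAnalytic` (px19 g20: ★★`firstDiff_of_analyticPairWindowAt` — the ONE-BOND first-difference bound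
`|f V − f U| ≤ (B∕r)·(‖w‖∕θ)` from the (β) text by the Schwarz lemma; `analyticPairWindowAt_bound_nonneg`), ✓p817898 `…RelPathWindow` (window vocabulary),
lit `T4ExpWindowSmallField.plaqSmall_of_bdev_le`, ✓`…OrganTangentJunctionDirectTransportCore.dist1_expPt_le_sqrt3_mul_norm`, Mathlib `Finset.piecewise`.

WHY.  After ✓(L38) p822302 + ✓(L39b) p822554 the REG′ halves of the four A2′ (I-law) blocks of row-sq v0.3 hang on three chart-primitive path moduli, among them (logρ-Lip):
«`s ↦ log ρ_Ts (Φ (X s, z))` is `Kρ`-Lipschitz on the sub-window set `{s ∈ Ioo (-1) 2 | PlaqSmall (24∕25·θ_Ts) (Φ (X s, z))}`».  The row's run prefix ALREADY gives, at every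
level `j₀ ≤ i ≤ T` (so at `i = Ts`), the (β) clause: one-bond-square analyticity of `log ρ_i`, `log ρ′_i` at every `PlaqSmall (49∕50·θ_i)` configuration, radius
`rA·(49∕50·θ_i)`, oscillation bound `Bρ i`.  This file shows that (β) + a BONDWISE EXPONENTIAL-INCREMENT letter on the fine curve is enough: no separate density letter.

WHAT.  §0 [folklore] `abs_sub_le_sum_of_chain` (telescoping a chain of differences; recorded for reuse, the induction below telescopes directly).  §1 hybrid fields: for two fine fields `U, U′` with `U′ e = U e·expPt (w e)` and
`‖w e‖ ≤ μ` for every bond, every HYBRID `A.piecewise U′ U` (bonds in `A` moved, the rest not) is in `PlaqSmall (θ₁ + 4·(√3·μ))` when `U ∈ PlaqSmall θ₁`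
(`plaqSmall_piecewise_of_incr`, via `plaqSmall_of_bdev_le`).  §2 ★★`abs_sub_le_of_beta_of_incr`: for ANY functional `f` carrying the (β) text at window `θ`, radius `r·θ`,
bound `B` (binder VERBATIM as in ✓`firstDiff_of_analyticPairWindowAt`) and two fine fields as in §1 with `θ₁ + 4·(√3·μ) ≤ θ`, `μ < r·θ`:
`|f U′ − f U| ≤ (B∕r)∕θ · Σ_e ‖w e‖` — induction over `Finset`s of bonds, one (β)-step per bond at the hybrid (which is in the window by §1).  §3 ★★★`lipschitzOnWith_of_beta_of_bondIncr`:
along a fine curve `c` on a parameter set `S` with `c s ∈ PlaqSmall θ₁` (`s ∈ S`) and the letter (Φ-bond-incr) «`∀ s s′ ∈ S, ∀ e, ∃ w, c s′ e = c s e·expPt w ∧ ‖w‖ ≤ k e·|s − s′|`»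
with `Σ_e k e ≤ K`, `k e·|s − s′| ≤ μ` on `S`, and the two smallness conditions: `LipschitzOnWith (toNNReal ((B∕r)·(K∕θ))) (f ∘ c) S`.  §4 ★★`logDensity_pathLip_of_beta`: the
organ reading — `f := log ρ_Ts` (or `log ρ′_Ts`), `θ := 49∕50·θ_Ts`, `r := rA`, `B := Bρ Ts`, `θ₁ := 24∕25·θ_Ts`, `S := {s ∈ Ioo (-1) 2 | PlaqSmall (24∕25·θ_Ts) (Φ (X s, z))}`: the
(logρ-Lip) letter shape of ✓p822554 with `Kρ := toNNReal ((Bρ∕rA)·(K∕(49∕50·θ_Ts)))`, from the (β) text at level `Ts` + (Φ-bond-incr) along `s ↦ Φ (X s, z)` + `4·(√3·μ) ≤ θ_Ts∕50`,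
`μ < rA·(49∕50·θ_Ts)`.  So, by kernel: REG′ ×4 ⟸ (β) [row prefix] + chart letters {(Φ-disp-Lip), (Φ-bond-incr), (J-Lip)} + frame.

HONEST FRAMING: [folklore] telescoping + window bookkeeping over HYPOTHESIS letters; (β) is a HYPOTHESIS of the row's run prefix (located: [Balaban1987RG1] Thm 1 ∕ (0.22)–(0.25),
SOURCE only), (Φ-bond-incr) is D0∕(P1) chart material — nothing here constructs Bałaban's chart or proves (β); nothing of Bałaban's analysis is asserted or proved; KER′, (I-curv),
(I-cov), `hdisp` untouched and OPEN; `OrganDischargeInputsHJ(sq)` ∕ `SpreadFibreLawH(J)(sq)` UNDISCHARGED; the five registered stubs of `Lines/semiclassical_s2beta.lean`, crux 20520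
and `YM3TorusSU2` are NOT proved; registry untouched; rung R3 = SU(2) YM₃ on T³ at fixed lattice data — NOT d = 4, NOT infinite volume, NOT a mass gap, NOT Clay; the Yang–Mills
mass gap is NOT proved.  [folklore]
-/

set_option autoImplicit false

noncomputable section

namespace Summit.QuantumFields.YangMills.Theorems.OrganTangentLogDensityPathLipOfBeta

open Set Function Metric
open scoped NNReal BigOperators
open Literature.MathematicalPhysics.QuantumFieldTheory.Balaban1983to89 T3ContinuumYM3Torus T3NestedUnitLaws
  T3UnitLawDensityEML T4Continuum BalabanUVClass T3UnitScaleTilt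
open T4CubeChartExp (expPt)
open T4ExpWindowSmallField (plaqSmall_of_bdev_le)
open T4TiltOscillation (bdev)
open Summit.QuantumFields.YangMills.Theorems.OrganTangentGradientFromAnalytic (firstDiff_of_analyticPairWindowAt analyticPairWindowAt_bound_nonneg)
open Summit.QuantumFields.YangMills.Theorems.OrganTangentJunctionDirectTransportCore (dist1_expPt_le_sqrt3_mul_norm)

/-! ## §0 Folklore: telescoping a chain -/

section Folklore

/-- Telescoping: step bounds along a chain bound the end-to-end difference by their sum. [folklore] -/
theorem abs_sub_le_sum_of_chain {α : Type*} (f : α → ℝ) (U : ℕ → α) (a : ℕ → ℝ) (n : ℕ)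
    (hstep : ∀ k < n, |f (U (k + 1)) - f (U k)| ≤ a k) : |f (U n) - f (U 0)| ≤ ∑ k ∈ Finset.range n, a k := by
  induction n with
  | zero => simp
  | succ n ih =>
    have h1 := ih fun k hk => hstep k (Nat.lt_succ_of_lt hk)
    have h2 := hstep n (Nat.lt_succ_self n)
    rw [Finset.sum_range_succ]
    calc |f (U (n + 1)) - f (U 0)| = |(f (U (n + 1)) - f (U n)) + (f (U n) - f (U 0))| := by ring_nf
      _ ≤ |f (U (n + 1)) - f (U n)| + |f (U n) - f (U 0)| := abs_add_le _ _
      _ ≤ a n + ∑ k ∈ Finset.range n, a k := add_le_add h2 h1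
      _ = ∑ k ∈ Finset.range n, a k + a n := add_comm _ _

end Folklore

/-! ## §1 Hybrid fields of two bondwise-close fine fields stay in the window -/

section Hybrid

variable {P : Params} {i : ℕ}

/-- ★ **HYBRIDS STAY IN THE WINDOW**: `U ∈ PlaqSmall θ₁`, `U′ e = U e·expPt (w e)` with `‖w e‖ ≤ μ` for every bond ⟹ for every finset `A` of bonds the hybrid `A.piecewise U′ U`
is in `PlaqSmall (θ₁ + 4·(√3·μ))`. [folklore] -/
theorem plaqSmall_piecewise_of_incr {θ₁ μ : ℝ} {U U' : GaugeField P i (Matrix.specialUnitaryGroup (Fin 2) ℂ)} (hU : PlaqSmall θ₁ U)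
    (w : PBond P i → Fin 3 → ℝ) (hincr : ∀ e, U' e = U e * expPt (w e)) (hμ : ∀ e, ‖w e‖ ≤ μ)
    (A : Finset (PBond P i)) [∀ e, Decidable (e ∈ A)] :
    PlaqSmall (θ₁ + 4 * (Real.sqrt 3 * μ)) (A.piecewise U' U) := by
  refine plaqSmall_of_bdev_le hU fun e => ?_
  rw [bdev, Finset.piecewise]
  by_cases he : e ∈ A
  · simp only [he, if_true]
    rw [hincr e, inv_mul_cancel_left]
    exact (dist1_expPt_le_sqrt3_mul_norm (w e)).trans (mul_le_mul_of_nonneg_left (hμ e) (Real.sqrt_nonneg 3))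
  · simp only [he, if_false]
    rw [inv_mul_cancel, GaugeGroup.dist1_one]
    have : 0 ≤ μ := (norm_nonneg _).trans (hμ e)
    positivity

end Hybrid

/-! ## §2 Two bondwise-close fields: the end-to-end bound from (β), one bond at a time -/

section TwoFields

variable {P : Params} {j : ℕ}

/-- ★★ **END-TO-END FIRST-DIFFERENCE BOUND FROM (β) ALONG BONDWISE EXPONENTIAL INCREMENTS**: for a functional `f` with the (β) text (window `θ`, radius `r·θ`, bound `B`), a
`θ₁`-window field `U` and `U′ e = U e·expPt (w e)` (`‖w e‖ ≤ μ`, `θ₁ + 4·(√3·μ) ≤ θ`, `μ < r·θ`): for every finset `A` of bonds,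
`|f (A.piecewise U′ U) − f U| ≤ (B∕r)∕θ · Σ_{e ∈ A} ‖w e‖`; at `A = univ` this is `|f U′ − f U|`. [folklore] -/
theorem abs_sub_piecewise_le_of_beta (θ r B : ℝ) (hθ : 0 < θ) (hr : 0 < r)
    (f : GaugeField P j ↥(Matrix.specialUnitaryGroup (Fin 2) ℂ) → ℝ)
    (hβ : ∀ (U : GaugeField P j ↥(Matrix.specialUnitaryGroup (Fin 2) ℂ)), PlaqSmall θ U →
      ∀ (b b' : PBond P j) (v v' : Fin 3 → ℝ), ‖v‖ ≤ 1 → ‖v'‖ ≤ 1 →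
        ∃ g : ℂ × ℂ → ℂ, DifferentiableOn ℂ g (Metric.ball (0 : ℂ) (r * θ) ×ˢ Metric.ball (0 : ℂ) (r * θ)) ∧
          (∀ (s t : ℝ) (V Z : GaugeField P j ↥(Matrix.specialUnitaryGroup (Fin 2) ℂ)), |s| < r * θ → |t| < r * θ →
            (∀ e, e ≠ b → V e = U e) → V b = U b * expPt (s • v) → (∀ e, e ≠ b' → Z e = V e) → Z b' = V b' * expPt (t • v') →
            g ((s : ℂ), (t : ℂ)) = ((f Z : ℝ) : ℂ)) ∧
          ∀ z ∈ Metric.ball (0 : ℂ) (r * θ) ×ˢ Metric.ball (0 : ℂ) (r * θ), ‖g z - g 0‖ ≤ B)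
    {θ₁ μ : ℝ} {U U' : GaugeField P j ↥(Matrix.specialUnitaryGroup (Fin 2) ℂ)} (hU : PlaqSmall θ₁ U)
    (w : PBond P j → Fin 3 → ℝ) (hincr : ∀ e, U' e = U e * expPt (w e)) (hμ : ∀ e, ‖w e‖ ≤ μ)
    (hwin : θ₁ + 4 * (Real.sqrt 3 * μ) ≤ θ) (hrad : μ < r * θ)
    (A : Finset (PBond P j)) [DecidableEq (PBond P j)] :
    |f (A.piecewise U' U) - f U| ≤ (B / r) / θ * ∑ e ∈ A, ‖w e‖ := by
  induction A using Finset.induction_on with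
  | empty => simp [Finset.piecewise_empty]
  | @insert a A ha ih =>
    have hA : PlaqSmall θ (A.piecewise U' U) := fun p => lt_of_lt_of_le (plaqSmall_piecewise_of_incr hU w hincr hμ A p) hwin
    -- one (β)-step at the hybrid `A.piecewise U′ U`, moving bond `a` by `w a`
    have hstep := firstDiff_of_analyticPairWindowAt θ r B hθ hr f hβ (A.piecewise U' U) hA a (w a) ((hμ a).trans_lt hrad)
      ((insert a A).piecewise U' U) (fun e he => Finset.piecewise_insert_of_ne A U' U he) (by
        rw [Finset.piecewise_insert_self, hincr a]
        congr 1
        rw [Finset.piecewise]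
        simp only [ha, if_false])
    rw [Finset.sum_insert ha, mul_add]
    calc |f ((insert a A).piecewise U' U) - f U|
        = |(f ((insert a A).piecewise U' U) - f (A.piecewise U' U)) + (f (A.piecewise U' U) - f U)| := by ring_nf
      _ ≤ |f ((insert a A).piecewise U' U) - f (A.piecewise U' U)| + |f (A.piecewise U' U) - f U| := abs_add_le _ _
      _ ≤ (B / r) * (‖w a‖ / θ) + (B / r) / θ * ∑ e ∈ A, ‖w e‖ := add_le_add hstep ih
      _ = (B / r) / θ * ‖w a‖ + (B / r) / θ * ∑ e ∈ A, ‖w e‖ := by ring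

/-- The `A = univ` reading: `|f U′ − f U| ≤ (B∕r)∕θ · Σ_e ‖w e‖`. [folklore] -/
theorem abs_sub_le_of_beta_of_incr (θ r B : ℝ) (hθ : 0 < θ) (hr : 0 < r)
    (f : GaugeField P j ↥(Matrix.specialUnitaryGroup (Fin 2) ℂ) → ℝ)
    (hβ : ∀ (U : GaugeField P j ↥(Matrix.specialUnitaryGroup (Fin 2) ℂ)), PlaqSmall θ U →
      ∀ (b b' : PBond P j) (v v' : Fin 3 → ℝ), ‖v‖ ≤ 1 → ‖v'‖ ≤ 1 →
        ∃ g : ℂ × ℂ → ℂ, DifferentiableOn ℂ g (Metric.ball (0 : ℂ) (r * θ) ×ˢ Metric.ball (0 : ℂ) (r * θ)) ∧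
          (∀ (s t : ℝ) (V Z : GaugeField P j ↥(Matrix.specialUnitaryGroup (Fin 2) ℂ)), |s| < r * θ → |t| < r * θ →
            (∀ e, e ≠ b → V e = U e) → V b = U b * expPt (s • v) → (∀ e, e ≠ b' → Z e = V e) → Z b' = V b' * expPt (t • v') →
            g ((s : ℂ), (t : ℂ)) = ((f Z : ℝ) : ℂ)) ∧
          ∀ z ∈ Metric.ball (0 : ℂ) (r * θ) ×ˢ Metric.ball (0 : ℂ) (r * θ), ‖g z - g 0‖ ≤ B)
    {θ₁ μ : ℝ} {U U' : GaugeField P j ↥(Matrix.specialUnitaryGroup (Fin 2) ℂ)} (hU : PlaqSmall θ₁ U)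
    (w : PBond P j → Fin 3 → ℝ) (hincr : ∀ e, U' e = U e * expPt (w e)) (hμ : ∀ e, ‖w e‖ ≤ μ)
    (hwin : θ₁ + 4 * (Real.sqrt 3 * μ) ≤ θ) (hrad : μ < r * θ) :
    |f U' - f U| ≤ (B / r) / θ * ∑ e, ‖w e‖ := by
  classical
  have h := abs_sub_piecewise_le_of_beta θ r B hθ hr f hβ hU w hincr hμ hwin hrad Finset.univ
  rwa [Finset.piecewise_univ] at h

end TwoFields

/-! ## §3 Along a fine curve: Lipschitz on the parameter set from (β) + (Φ-bond-incr) -/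

section Curve

variable {P : Params} {j : ℕ}

/-- ★★★ **PATH-LIPSCHITZ FROM (β) + BONDWISE INCREMENTS**: `f` with the (β) text (window `θ`, radius `r·θ`, bound `B`); a fine curve `c` with `c s ∈ PlaqSmall θ₁` on `S` and the
letter (Φ-bond-incr) «`∀ s s′ ∈ S, ∀ e, ∃ w, c s′ e = c s e·expPt w ∧ ‖w‖ ≤ k e·|s − s′|`», `Σ_e k e ≤ K`, with `k e·|s − s′| ≤ μ` on `S` and `θ₁ + 4·(√3·μ) ≤ θ`, `μ < r·θ`
⟹ `LipschitzOnWith (toNNReal ((B∕r)·(K∕θ))) (f ∘ c) S`. [folklore] -/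
theorem lipschitzOnWith_of_beta_of_bondIncr (θ r B : ℝ) (hθ : 0 < θ) (hr : 0 < r)
    (f : GaugeField P j ↥(Matrix.specialUnitaryGroup (Fin 2) ℂ) → ℝ)
    (hβ : ∀ (U : GaugeField P j ↥(Matrix.specialUnitaryGroup (Fin 2) ℂ)), PlaqSmall θ U →
      ∀ (b b' : PBond P j) (v v' : Fin 3 → ℝ), ‖v‖ ≤ 1 → ‖v'‖ ≤ 1 →
        ∃ g : ℂ × ℂ → ℂ, DifferentiableOn ℂ g (Metric.ball (0 : ℂ) (r * θ) ×ˢ Metric.ball (0 : ℂ) (r * θ)) ∧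
          (∀ (s t : ℝ) (V Z : GaugeField P j ↥(Matrix.specialUnitaryGroup (Fin 2) ℂ)), |s| < r * θ → |t| < r * θ →
            (∀ e, e ≠ b → V e = U e) → V b = U b * expPt (s • v) → (∀ e, e ≠ b' → Z e = V e) → Z b' = V b' * expPt (t • v') →
            g ((s : ℂ), (t : ℂ)) = ((f Z : ℝ) : ℂ)) ∧
          ∀ z ∈ Metric.ball (0 : ℂ) (r * θ) ×ˢ Metric.ball (0 : ℂ) (r * θ), ‖g z - g 0‖ ≤ B)
    {θ₁ μ K : ℝ} (c : ℝ → GaugeField P j ↥(Matrix.specialUnitaryGroup (Fin 2) ℂ)) (S : Set ℝ) (hS : ∀ s ∈ S, PlaqSmall θ₁ (c s))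
    (k : PBond P j → ℝ) (hK : ∑ e, k e ≤ K) (hkμ : ∀ e, ∀ s ∈ S, ∀ s' ∈ S, k e * |s - s'| ≤ μ)
    (hincr : ∀ s ∈ S, ∀ s' ∈ S, ∀ e, ∃ w : Fin 3 → ℝ, c s' e = c s e * expPt w ∧ ‖w‖ ≤ k e * |s - s'|)
    (hwin : θ₁ + 4 * (Real.sqrt 3 * μ) ≤ θ) (hrad : μ < r * θ) :
    LipschitzOnWith (Real.toNNReal ((B / r) * (K / θ))) (fun s => f (c s)) S := by
  classical
  refine LipschitzOnWith.of_dist_le_mul fun s' hs' s hs => ?_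
  rw [Real.dist_eq, Real.dist_eq]
  -- the bondwise increments from `c s` to `c s′`
  choose w hw using fun e => hincr s hs s' hs' e
  have hμe : ∀ e, ‖w e‖ ≤ μ := fun e => (hw e).2.trans (hkμ e s hs s' hs')
  -- `c s` itself is a hybrid (`A = ∅`), hence in the `θ`-window: `B ≥ 0`
  have hcs : PlaqSmall θ (c s) := by
    have h := plaqSmall_piecewise_of_incr (hS s hs) w (fun e => (hw e).1) hμe ∅
    rw [Finset.piecewise_empty] at h
    exact fun p => lt_of_lt_of_le (h p) hwin
  -- no bonds: all fields coincide; else `B ≥ 0` from (β) at `c s`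
  rcases isEmpty_or_nonempty (PBond P j) with hE | ⟨⟨e₀⟩⟩
  · have hcc : c s' = c s := funext fun e => (hE.false e).elim
    rw [hcc, sub_self, abs_zero]
    positivity
  have hB0 : 0 ≤ B := analyticPairWindowAt_bound_nonneg θ r B hθ hr f hβ (c s) hcs e₀
  have hc0 : 0 ≤ (B / r) / θ := by positivity
  have hmain := abs_sub_le_of_beta_of_incr θ r B hθ hr f hβ (hS s hs) w (fun e => (hw e).1) hμe hwin hrad
  have hsum : ∑ e, ‖w e‖ ≤ K * |s - s'| := by
    calc ∑ e, ‖w e‖ ≤ ∑ e, k e * |s - s'| := Finset.sum_le_sum fun e _ => (hw e).2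
      _ = (∑ e, k e) * |s - s'| := by rw [Finset.sum_mul]
      _ ≤ K * |s - s'| := mul_le_mul_of_nonneg_right hK (abs_nonneg _)
  calc |f (c s') - f (c s)| ≤ (B / r) / θ * ∑ e, ‖w e‖ := hmain
    _ ≤ (B / r) / θ * (K * |s - s'|) := mul_le_mul_of_nonneg_left hsum hc0
    _ = ((B / r) * (K / θ)) * |s' - s| := by rw [abs_sub_comm]; ring
    _ ≤ (Real.toNNReal ((B / r) * (K / θ)) : ℝ) * |s' - s| := mul_le_mul_of_nonneg_right (Real.le_coe_toNNReal _) (abs_nonneg _)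

end Curve

/-! ## §4 The organ reading: (logρ-Lip) of ✓(L39b) from the row's (β) at level `Ts` + (Φ-bond-incr) -/

section Organ

/-- ★★ **(logρ-Lip) FROM (β) + (Φ-bond-incr)** — for a level-`Ts` density `ρT` carrying the row's (β) text at level `Ts` (window `49∕50·θ_Ts`, radius `rA·(49∕50·θ_Ts)`, bound `BρT`;
binder VERBATIM as in the run prefix of `OrganDischargeInputsHJsq` ∕ `SpreadFibreLawH` at `j := Ts`), a fibred chart `Φ`, a coarse curve `X`, a fibre point `z`, and the bondwise
exponential-increment letter (Φ-bond-incr) for the fine curve `s ↦ Φ (X s, z)` on the sub-window set `S = {s ∈ Ioo (-1) 2 | PlaqSmall (24∕25·θ_Ts) (Φ (X s, z))}` with speeds `k`,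
`Σ_e k e ≤ K`, `k e·|s − s′| ≤ μ` on `S`, `4·(√3·μ) ≤ θ_Ts∕50`, `μ < rA·(49∕50·θ_Ts)`: the (logρ-Lip) letter of ✓`weightLip_of_chartLetters` for `ρT` along `X` at `z`, with
`Kρ := toNNReal ((BρT∕rA)·(K∕(49∕50·θ_Ts)))`. [folklore] -/
theorem logDensity_pathLip_of_beta (F : T3Family) (γ b₀ p₀ : ℝ) (j Ts : ℕ)
    (ρT : GaugeField (F.P Ts) 0 ↥(Matrix.specialUnitaryGroup (Fin 2) ℂ) → ℝ) (rA BρT : ℝ) (hrA : 0 < rA) (hθT : 0 < θBal F.L γ b₀ p₀ Ts)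
    (hβ : ∀ (U : GaugeField (F.P Ts) 0 ↥(Matrix.specialUnitaryGroup (Fin 2) ℂ)), PlaqSmall (49 / 50 * θBal F.L γ b₀ p₀ Ts) U →
      ∀ (b b' : PBond (F.P Ts) 0) (v v' : Fin 3 → ℝ), ‖v‖ ≤ 1 → ‖v'‖ ≤ 1 →
        ∃ g : ℂ × ℂ → ℂ, DifferentiableOn ℂ g (Metric.ball (0 : ℂ) (rA * (49 / 50 * θBal F.L γ b₀ p₀ Ts)) ×ˢ Metric.ball (0 : ℂ) (rA * (49 / 50 * θBal F.L γ b₀ p₀ Ts))) ∧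
          (∀ (s t : ℝ) (V Z : GaugeField (F.P Ts) 0 ↥(Matrix.specialUnitaryGroup (Fin 2) ℂ)), |s| < rA * (49 / 50 * θBal F.L γ b₀ p₀ Ts) → |t| < rA * (49 / 50 * θBal F.L γ b₀ p₀ Ts) →
            (∀ e, e ≠ b → V e = U e) → V b = U b * expPt (s • v) → (∀ e, e ≠ b' → Z e = V e) → Z b' = V b' * expPt (t • v') →
            g ((s : ℂ), (t : ℂ)) = (((Real.log (ρT Z)) : ℝ) : ℂ)) ∧
          ∀ z ∈ Metric.ball (0 : ℂ) (rA * (49 / 50 * θBal F.L γ b₀ p₀ Ts)) ×ˢ Metric.ball (0 : ℂ) (rA * (49 / 50 * θBal F.L γ b₀ p₀ Ts)), ‖g z - g 0‖ ≤ BρT)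
    {Z : Type} (Φ : GaugeField (F.P j) 0 ↥(Matrix.specialUnitaryGroup (Fin 2) ℂ) × Z → GaugeField (F.P Ts) 0 ↥(Matrix.specialUnitaryGroup (Fin 2) ℂ))
    (X : ℝ → GaugeField (F.P j) 0 ↥(Matrix.specialUnitaryGroup (Fin 2) ℂ)) (z : Z) {μ K : ℝ} (k : PBond (F.P Ts) 0 → ℝ) (hK : ∑ e, k e ≤ K)
    (hkμ : ∀ e, ∀ s ∈ {s | s ∈ Set.Ioo (-1 : ℝ) 2 ∧ PlaqSmall (24 / 25 * θBal F.L γ b₀ p₀ Ts) (Φ (X s, z))},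
      ∀ s' ∈ {s | s ∈ Set.Ioo (-1 : ℝ) 2 ∧ PlaqSmall (24 / 25 * θBal F.L γ b₀ p₀ Ts) (Φ (X s, z))}, k e * |s - s'| ≤ μ)
    (hincr : ∀ s ∈ {s | s ∈ Set.Ioo (-1 : ℝ) 2 ∧ PlaqSmall (24 / 25 * θBal F.L γ b₀ p₀ Ts) (Φ (X s, z))},
      ∀ s' ∈ {s | s ∈ Set.Ioo (-1 : ℝ) 2 ∧ PlaqSmall (24 / 25 * θBal F.L γ b₀ p₀ Ts) (Φ (X s, z))},
      ∀ e, ∃ w : Fin 3 → ℝ, Φ (X s', z) e = Φ (X s, z) e * expPt w ∧ ‖w‖ ≤ k e * |s - s'|)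
    (hwin : 4 * (Real.sqrt 3 * μ) ≤ θBal F.L γ b₀ p₀ Ts / 50) (hrad : μ < rA * (49 / 50 * θBal F.L γ b₀ p₀ Ts)) :
    LipschitzOnWith (Real.toNNReal ((BρT / rA) * (K / (49 / 50 * θBal F.L γ b₀ p₀ Ts)))) (fun s => Real.log (ρT (Φ (X s, z))))
      {s | s ∈ Set.Ioo (-1 : ℝ) 2 ∧ PlaqSmall (24 / 25 * θBal F.L γ b₀ p₀ Ts) (Φ (X s, z))} :=
  lipschitzOnWith_of_beta_of_bondIncr (49 / 50 * θBal F.L γ b₀ p₀ Ts) rA BρT (by positivity) hrA (fun Z => Real.log (ρT Z)) hβ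
    (fun s => Φ (X s, z)) _ (fun s hs => hs.2) k hK hkμ hincr (by linarith) hrad

end Organ


end Summit.QuantumFields.YangMills.Theorems.OrganTangentLogDensityPathLipOfBeta

end
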